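import Summits.AtomisticToContinuum.Crystallization.Theorems.IsometryAtomsMinimisingLawsCohesiveNoSlabsAux2
import Summits.AtomisticToContinuum.Crystallization.Theorems.PalmUnimodularRigidityCruxesToPalmRigidity
import Summits.AtomisticToContinuum.Crystallization.Theorems.PalmUnimodularRigidityBenjaminiSchrammLimitEmbedding
import Summits.AtomisticToContinuum.Crystallization.Theorems.MinimisingLawsCohesive.Negative.OnePointMixtures
import Summits.AtomisticToContinuum.Crystallization.Theses.IsometryAtoms

/-!
# Minimising laws charge no slabs: stub `stub_noSlabs` of line `purity_stacking` of crux
# `IsometryAtoms.MinimisingLawsCohesive` (stmt-AtomisticToContinuum-15777)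

**Theorem** (`stub_noSlabs`, registered stub; proved exactly as registered).  Assume the energy
floor: `e* = ⨅_Q e_LJ(Q) ≤ E_P[rootEnergy]` for every `δ > 0` and every point-stationary
(`IsPointStationaryLaw`) probability law `P` a.s. carried by rooted `δ`-hard-core configurations
(`IsRootedHardCore`).  Then a MINIMISING such law (`E_P[rootEnergy] ≤ e*`) almost surely charges
no SLAB configuration: a.s. there is no linear isometry `A` and `D` with `|A y 0| ≤ D` for all
points `y` of the configuration.

**Proof (stacking).**  (helper files `…NoSlabsAux1/2`)
1. A slab configuration `count|S` has NO BAD PAIR for some period `v = t e_j`, `j : Fin 3`,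
   `t ∈ ℕ`, `t ≥ 2` (`1 ≤ ‖s - s' - k v‖` for `s, s' ∈ S`, `k ≠ 0`;
   `noSlabs_exists_noBadPair_of_slab`), i.e. it lies in the STACKING EVENT of `v`, a measurable
   event described by countably many ball evaluations (`count_restrict_mem_stackEvent_iff`),
   invariant under re-rooting of counting measures.  There are countably many `(j, t)`.
2. Each stacking event `H` of a `v` with `‖v‖ > 1` is `P`-null (`measure_stackEvent_eq_zero`):
   else the conditioned law `P(· | H)` is again in the frame and minimising
   (`meanRootEnergy_cond_le_of_minimising_ae`, using the floor and `e* < 0`); its image under the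
   stacking map `T_v μ = Σₖ θ_{k v} μ` is a probability law, a.s. rooted `min δ 1`-hard-core
   (`noSlabs_isRootedHardCore_stack`, measurability of the hard-core class), point-stationary
   (`isPointStationaryLaw_map_stack`, this file: Mecke for the transport `Σₖ g(T_v μ, y - k v)`,
   periodicity of `T_v μ` and the reindexing `k ↦ -k`; Campbell integrals are made measurable by the
   s-finite kernel of `exists_isSFiniteKernel_apply_eq_self`), and has mean root energy
   `≤ E_{P(·|H)}[h] + V_LJ(‖v‖)/2 < e*` (`rootEnergy'_stack_le`, `lennardJones_neg`) — contradicting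
   the floor.
3. Hence a.s. the (hard-core) configuration lies in no stacking event `t e_j`, so it is no slab.
-/

noncomputable section

open MeasureTheory Set Filter Metric TopologicalSpace
open scoped ENNReal

namespace Summit.AtomisticToContinuum.Crystallization.Theorems.IsometryAtomsMinimisingLawsCohesive

namespace NoSlabs

open Literature.Probability.Process
open Literature.MathematicalPhysics.StatisticalMechanics (lennardJones)
open Summit.AtomisticToContinuum.Crystallization.Theorems.MinimiserShells.Negative.LoadBearing
  (eStar meanRootEnergy)
open Summit.AtomisticToContinuum.Crystallization.Theorems.PalmUnimodularRigidityMinimiserShells.EnergyFloor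
  (rootEnergy' measurable_rootEnergy' rootEnergy'_eq_of_hc rootEnergy'_bounds_of_hc)
open Summit.AtomisticToContinuum.Crystallization.Theorems.PalmUnimodularRigidity
  (exists_isSFiniteKernel_apply_eq_self measurable_map_sub_kernel measurableSet_floorNorm_preimage
    count_restrict_floorNorm_preimage_lt_top)
open Summit.AtomisticToContinuum.Crystallization.Theorems.BenjaminiSchrammLimit
  (measurableSet_setOf_isRootedHardCore)

/-! ## The stacked law is point-stationary

For a point-stationary law `P₀` a.s. carried by rooted hard-core configurations in the stacking
event of `v`, the image law `P₀ ∘ T_v⁻¹` again satisfies the Mecke identity: apply Mecke for `P₀`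
to the transport `G(μ, y) = Σₖ g(T_v μ, y - k v)` and use `T_v (θ_y μ) = θ_y (T_v μ)`, the
periodicity `θ_{y - k v} (T_v μ) = θ_y (T_v μ)` and the reindexing `k ↦ -k`.  The Campbell
integrals `ν ↦ ∫ g(ν, z) dν(z)` are only a.e.-measurable: on locally finite configurations they
are integrals against the s-finite kernel of `exists_isSFiniteKernel_apply_eq_self`. -/

/-- **The stacked law of a point-stationary law is point-stationary.** -/
theorem isPointStationaryLaw_map_stack {δ : ℝ} (hδ : 0 < δ) (v : EuclideanSpace ℝ (Fin 3))
    {P₀ : Measure (Measure (EuclideanSpace ℝ (Fin 3)))} (hstat : IsPointStationaryLaw P₀)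
    (hae : ∀ᵐ μ ∂P₀, IsRootedHardCore δ μ ∧
      μ ∈ {μ : Measure (EuclideanSpace ℝ (Fin 3)) | ∀ k : ℤ, k ≠ 0 → ∀ n a : ℕ,
        μ (Metric.ball (TopologicalSpace.denseSeq (EuclideanSpace ℝ (Fin 3)) n) (1 / ((a : ℝ) + 1))) = 0 ∨
        μ (Metric.ball (TopologicalSpace.denseSeq (EuclideanSpace ℝ (Fin 3)) n - (k : ℝ) • v)
          (1 - 1 / ((a : ℝ) + 1))) = 0}) :
    IsPointStationaryLaw (P₀.map (fun μ : Measure (EuclideanSpace ℝ (Fin 3)) =>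
      Measure.sum (fun k : ℤ => μ.map (fun z => z - (k : ℝ) • v)))) := by
  set T : Measure (EuclideanSpace ℝ (Fin 3)) → Measure (EuclideanSpace ℝ (Fin 3)) :=
    fun μ => Measure.sum (fun k : ℤ => μ.map (fun z => z - (k : ℝ) • v)) with hT_def
  have hT : Measurable T := measurable_stack v
  -- the locally finite class (norm shells)
  set shell : ℕ → Set (EuclideanSpace ℝ (Fin 3)) :=
    fun n => (fun z : EuclideanSpace ℝ (Fin 3) => ⌊‖z‖⌋₊) ⁻¹' {n} with hshell
  set LF : Set (Measure (EuclideanSpace ℝ (Fin 3))) := {ν | ∀ n : ℕ, ν (shell n) < ⊤} with hLF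
  have hLFm : MeasurableSet LF := measurableSet_setOf.2 (Measurable.forall fun n =>
    measurableSet_setOf.1 (measurableSet_lt (Measure.measurable_coe (measurableSet_floorNorm_preimage n))
      measurable_const))
  have hδ' : 0 < min δ 1 := lt_min hδ one_pos
  have h1 : ∀ᵐ μ ∂P₀, T μ ∈ LF := hae.mono fun μ hμ => by
    obtain ⟨S', -, hsep', hS'⟩ := isRootedHardCore_stack_of_mem hδ hμ.1 v hμ.2
    intro n
    show T μ (shell n) < ⊤
    rw [show T μ = _ from hS']
    exact count_restrict_floorNorm_preimage_lt_top hδ' hsep' n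
  have h1' : ∀ᵐ ν ∂(P₀.map T), ν ∈ LF := (ae_map_iff hT.aemeasurable hLFm).2 h1
  -- an s-finite kernel that is the identity on locally finite configurations
  obtain ⟨κ, hκ, hκid⟩ := exists_isSFiniteKernel_apply_eq_self shell
    (fun n => measurableSet_floorNorm_preimage n)
    (fun i j hij => Set.disjoint_iff.2 fun z hz => hij (hz.1.symm.trans hz.2)) (fun z => ⟨⌊‖z‖⌋₊, rfl⟩)
  haveI := hκ
  have hmr : Measurable fun p : Measure (EuclideanSpace ℝ (Fin 3)) × EuclideanSpace ℝ (Fin 3) =>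
      (κ p.1).map (fun z => z - p.2) := measurable_map_sub_kernel κ
  have hreroot : ∀ ν ∈ LF, Measurable fun y : EuclideanSpace ℝ (Fin 3) => ν.map (fun w => w - y) := by
    intro ν hν
    have h := hmr.comp (measurable_const.prodMk measurable_id :
      Measurable fun y : EuclideanSpace ℝ (Fin 3) => (ν, y))
    convert h using 1
    funext y
    simp only [Function.comp_apply, hκid ν hν]
  intro g hg
  have hgν : ∀ ν : Measure (EuclideanSpace ℝ (Fin 3)), Measurable (g ν) := fun ν =>
    hg.comp measurable_prodMk_left
  -- transfer of both sides to `P₀`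
  have hF : Measurable fun ν : Measure (EuclideanSpace ℝ (Fin 3)) => ∫⁻ z, g ν z ∂(κ ν) :=
    hg.lintegral_kernel_prod_right
  have hLHS : ∫⁻ ν, ∫⁻ z, g ν z ∂ν ∂(P₀.map T) = ∫⁻ μ, ∫⁻ z, g (T μ) z ∂(T μ) ∂P₀ := by
    calc ∫⁻ ν, ∫⁻ z, g ν z ∂ν ∂(P₀.map T) = ∫⁻ ν, ∫⁻ z, g ν z ∂(κ ν) ∂(P₀.map T) :=
          lintegral_congr_ae (h1'.mono fun ν hν => by beta_reduce; rw [hκid ν hν])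
      _ = ∫⁻ μ, ∫⁻ z, g (T μ) z ∂(κ (T μ)) ∂P₀ := lintegral_map hF hT
      _ = ∫⁻ μ, ∫⁻ z, g (T μ) z ∂(T μ) ∂P₀ :=
          lintegral_congr_ae (h1.mono fun μ hμ => by beta_reduce; rw [hκid _ hμ])
  have hF' : Measurable fun ν : Measure (EuclideanSpace ℝ (Fin 3)) =>
      ∫⁻ z, g ((κ ν).map (fun w => w - z)) (-z) ∂(κ ν) := by
    have h : Measurable (Function.uncurry fun (ν : Measure (EuclideanSpace ℝ (Fin 3)))
        (z : EuclideanSpace ℝ (Fin 3)) => g ((κ ν).map (fun w => w - z)) (-z)) :=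
      hg.comp (hmr.prodMk measurable_snd.neg)
    exact h.lintegral_kernel_prod_right
  have hRHS : ∫⁻ ν, ∫⁻ z, g (ν.map (fun w => w - z)) (-z) ∂ν ∂(P₀.map T) =
      ∫⁻ μ, ∫⁻ z, g ((T μ).map (fun w => w - z)) (-z) ∂(T μ) ∂P₀ := by
    calc ∫⁻ ν, ∫⁻ z, g (ν.map (fun w => w - z)) (-z) ∂ν ∂(P₀.map T)
        = ∫⁻ ν, ∫⁻ z, g ((κ ν).map (fun w => w - z)) (-z) ∂(κ ν) ∂(P₀.map T) :=
          lintegral_congr_ae (h1'.mono fun ν hν => by beta_reduce; rw [hκid ν hν])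
      _ = ∫⁻ μ, ∫⁻ z, g ((κ (T μ)).map (fun w => w - z)) (-z) ∂(κ (T μ)) ∂P₀ := lintegral_map hF' hT
      _ = ∫⁻ μ, ∫⁻ z, g ((T μ).map (fun w => w - z)) (-z) ∂(T μ) ∂P₀ :=
          lintegral_congr_ae (h1.mono fun μ hμ => by beta_reduce; rw [hκid _ hμ])
  rw [hLHS, hRHS]
  -- the Mecke transport `G(μ, y) = Σₖ g(T μ, y - k v)`
  set Gg : Measure (EuclideanSpace ℝ (Fin 3)) → EuclideanSpace ℝ (Fin 3) → ℝ≥0∞ :=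
    fun μ y => ∑' k : ℤ, g (T μ) (y - (k : ℝ) • v) with hGg
  have hGgm : Measurable (Function.uncurry Gg) := by
    refine Measurable.tsum fun k => ?_
    exact hg.comp ((hT.comp measurable_fst).prodMk (measurable_snd.sub_const _))
  have hM := hstat Gg hGgm
  have hL2 : ∀ μ, ∫⁻ z, g (T μ) z ∂(T μ) = ∫⁻ y, Gg μ y ∂μ := by
    intro μ
    rw [show (∫⁻ z, g (T μ) z ∂(T μ)) = ∑' k : ℤ, ∫⁻ y, g (T μ) (y - (k : ℝ) • v) ∂μ from
      lintegral_stack v μ _]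
    have hmk : ∀ k : ℤ, AEMeasurable (fun y => g (T μ) (y - (k : ℝ) • v)) μ := fun k =>
      ((hgν _).comp (measurable_sub_const _)).aemeasurable
    simp only [hGg]
    rw [lintegral_tsum hmk]
  have hR2 : ∀ᵐ μ ∂P₀, ∫⁻ z, g ((T μ).map (fun w => w - z)) (-z) ∂(T μ) =
      ∫⁻ y, Gg (μ.map (fun w => w - y)) (-y) ∂μ := by
    refine h1.mono fun μ hμ => ?_
    rw [show (∫⁻ z, g ((T μ).map (fun w => w - z)) (-z) ∂(T μ)) =
      ∑' k : ℤ, ∫⁻ y, g ((T μ).map (fun w => w - (y - (k : ℝ) • v))) (-(y - (k : ℝ) • v)) ∂μ from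
      lintegral_stack v μ _]
    have hper : ∀ (y : EuclideanSpace ℝ (Fin 3)) (k : ℤ),
        (T μ).map (fun w => w - (y - (k : ℝ) • v)) = (T μ).map (fun w => w - y) :=
      fun y k => stack_map_sub_sub_period v μ y k
    have hcomm : ∀ y : EuclideanSpace ℝ (Fin 3), T (μ.map (fun w => w - y)) = (T μ).map (fun w => w - y) :=
      fun y => stack_map_sub v μ y
    simp only [hper, hGg, hcomm]
    have hmk : ∀ k : ℤ,
        AEMeasurable (fun y => g ((T μ).map (fun w => w - y)) (-y - (k : ℝ) • v)) μ := fun k =>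
      (hg.comp ((hreroot _ hμ).prodMk (measurable_neg.sub_const _))).aemeasurable
    rw [lintegral_tsum hmk]
    rw [show (∑' k : ℤ, ∫⁻ y, g ((T μ).map (fun w => w - y)) (-y - (k : ℝ) • v) ∂μ) =
        ∑' k : ℤ, ∫⁻ y, g ((T μ).map (fun w => w - y)) (-y - ((-k : ℤ) : ℝ) • v) ∂μ from
      ((Equiv.neg ℤ).tsum_eq (fun k : ℤ =>
        ∫⁻ y, g ((T μ).map (fun w => w - y)) (-y - (k : ℝ) • v) ∂μ)).symm]
    refine tsum_congr fun k => lintegral_congr fun y => ?_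
    simp only [Int.cast_neg, neg_smul]
    congr 1
    abel
  calc ∫⁻ μ, ∫⁻ z, g (T μ) z ∂(T μ) ∂P₀ = ∫⁻ μ, ∫⁻ y, Gg μ y ∂μ ∂P₀ := lintegral_congr fun μ => hL2 μ
    _ = ∫⁻ μ, ∫⁻ y, Gg (μ.map (fun w => w - y)) (-y) ∂μ ∂P₀ := hM
    _ = ∫⁻ μ, ∫⁻ z, g ((T μ).map (fun w => w - z)) (-z) ∂(T μ) ∂P₀ := (lintegral_congr_ae hR2).symm

/-! ## Assembly: stacking events are null under a minimising law -/

/-- **Stacking events are null.** Given the energy floor and `e* < 0`, a minimising point-stationary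
`δ`-hard-core probability law gives probability `0` to the stacking event of every period vector `v`
with `‖v‖ > 1`: otherwise the conditioned law is minimising, its stacked law is in the frame
(probability, a.s. `min δ 1`-hard-core, point-stationary) with mean root energy
`≤ e* + V_LJ(‖v‖)/2 < e*`, contradicting the floor. -/
theorem measure_stackEvent_eq_zero (heneg : eStar < 0)
    (hU : ∀ δ : ℝ, 0 < δ → ∀ P : Measure (Measure (EuclideanSpace ℝ (Fin 3))), IsProbabilityMeasure P →
      (∀ᵐ μ ∂P, IsRootedHardCore δ μ) → IsPointStationaryLaw P → eStar ≤ meanRootEnergy P)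
    {δ : ℝ} (hδ : 0 < δ) (P : Measure (Measure (EuclideanSpace ℝ (Fin 3)))) [IsProbabilityMeasure P]
    (hcore : ∀ᵐ μ ∂P, IsRootedHardCore δ μ) (hstat : IsPointStationaryLaw P)
    (hE : meanRootEnergy P ≤ eStar) {v : EuclideanSpace ℝ (Fin 3)} (hv : 1 < ‖v‖) :
    P {μ : Measure (EuclideanSpace ℝ (Fin 3)) | ∀ k : ℤ, k ≠ 0 → ∀ n a : ℕ,
      μ (Metric.ball (TopologicalSpace.denseSeq (EuclideanSpace ℝ (Fin 3)) n) (1 / ((a : ℝ) + 1))) = 0 ∨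
      μ (Metric.ball (TopologicalSpace.denseSeq (EuclideanSpace ℝ (Fin 3)) n - (k : ℝ) • v)
        (1 - 1 / ((a : ℝ) + 1))) = 0} = 0 := by
  by_contra hne
  set H := {μ : Measure (EuclideanSpace ℝ (Fin 3)) | ∀ k : ℤ, k ≠ 0 → ∀ n a : ℕ,
      μ (Metric.ball (TopologicalSpace.denseSeq (EuclideanSpace ℝ (Fin 3)) n) (1 / ((a : ℝ) + 1))) = 0 ∨
      μ (Metric.ball (TopologicalSpace.denseSeq (EuclideanSpace ℝ (Fin 3)) n - (k : ℝ) • v)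
        (1 - 1 / ((a : ℝ) + 1))) = 0} with hH
  have hHm : MeasurableSet H := measurableSet_stackEvent v
  have hinv : ∀ᵐ μ ∂P, ∀ᵐ y ∂μ,
      (Measure.map (fun z : EuclideanSpace ℝ (Fin 3) => z - y) μ ∈ H ↔ μ ∈ H) :=
    hcore.mono fun μ hμ => by
      obtain ⟨S, -, -, rfl⟩ := hμ
      exact Eventually.of_forall fun y => map_sub_count_restrict_mem_stackEvent_iff S v y
  set PH : Measure (Measure (EuclideanSpace ℝ (Fin 3))) := (P H)⁻¹ • P.restrict H with hPH
  have hp_top : P H ≠ ⊤ := measure_ne_top P H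
  haveI : IsProbabilityMeasure PH := ⟨by
    rw [hPH, Measure.smul_apply, Measure.restrict_apply MeasurableSet.univ, Set.univ_inter,
      smul_eq_mul, ENNReal.inv_mul_cancel hne hp_top]⟩
  have hstatH : IsPointStationaryLaw PH :=
    (isPointStationaryLaw_restrict_of_ae hstat hHm hinv).smul _
  have hcoreH : ∀ᵐ μ ∂PH, IsRootedHardCore δ μ ∧ μ ∈ H := by
    rw [hPH]
    refine Measure.ae_smul_measure ?_ _
    have h1 : ∀ᵐ μ ∂(P.restrict H), μ ∈ H := ae_restrict_mem hHm
    have h2 : ∀ᵐ μ ∂(P.restrict H), IsRootedHardCore δ μ := ae_restrict_of_ae hcore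
    filter_upwards [h1, h2] with μ h1 h2 using ⟨h2, h1⟩
  have hEH : meanRootEnergy PH ≤ eStar :=
    meanRootEnergy_cond_le_of_minimising_ae heneg hU hδ P hcore hstat hE hHm hinv hne
  -- the stacked law
  set T : Measure (EuclideanSpace ℝ (Fin 3)) → Measure (EuclideanSpace ℝ (Fin 3)) :=
    fun μ => Measure.sum (fun k : ℤ => μ.map (fun z => z - (k : ℝ) • v)) with hT
  have hTm : Measurable T := measurable_stack v
  set P' : Measure (Measure (EuclideanSpace ℝ (Fin 3))) := PH.map T with hP'
  haveI : IsProbabilityMeasure P' := Measure.isProbabilityMeasure_map hTm.aemeasurable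
  have hδ' : 0 < min δ 1 := lt_min hδ one_pos
  have hcT : ∀ᵐ μ ∂PH, IsRootedHardCore (min δ 1) (T μ) :=
    hcoreH.mono fun μ hμ => isRootedHardCore_stack_of_mem hδ hμ.1 v hμ.2
  have hcore' : ∀ᵐ ν ∂P', IsRootedHardCore (min δ 1) ν :=
    (ae_map_iff hTm.aemeasurable (measurableSet_setOf_isRootedHardCore hδ')).2 hcT
  have hstat' : IsPointStationaryLaw P' := isPointStationaryLaw_map_stack hδ v hstatH hcoreH
  have hfloor : eStar ≤ meanRootEnergy P' := hU _ hδ' P' inferInstance hcore' hstat'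
  -- the energy drop, integrated
  have hdrop : meanRootEnergy P' ≤ meanRootEnergy PH + lennardJones ‖v‖ / 2 := by
    set C : ℝ := 250 / 12 * (min δ 1)⁻¹ ^ 6 + 250 / 24 * (min δ 1)⁻¹ ^ 12 with hC
    have hC1 : (0 : ℝ) ≤ 250 / 12 * (min δ 1)⁻¹ ^ 6 := by positivity
    have hC2 : (0 : ℝ) ≤ 250 / 24 * (min δ 1)⁻¹ ^ 12 := by positivity
    have hbd : ∀ ν : Measure (EuclideanSpace ℝ (Fin 3)), IsRootedHardCore (min δ 1) ν →
        ‖rootEnergy' ν‖ ≤ C := fun ν hν => by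
      obtain ⟨h1, h2⟩ := rootEnergy'_bounds_of_hc hδ' hν
      rw [Real.norm_eq_abs, abs_le]
      constructor <;> linarith
    have hcoreH' : ∀ᵐ μ ∂PH, IsRootedHardCore (min δ 1) μ :=
      hcoreH.mono fun μ hμ => hμ.1.mono (min_le_left _ _)
    have hint1 : Integrable (fun μ => rootEnergy' (T μ)) PH :=
      Integrable.of_bound (measurable_rootEnergy'.comp hTm).aestronglyMeasurable C
        (hcT.mono fun μ hμ => hbd _ hμ)
    have hint2 : Integrable rootEnergy' PH :=
      Integrable.of_bound measurable_rootEnergy'.aestronglyMeasurable C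
        (hcoreH'.mono fun μ hμ => hbd _ hμ)
    have hae1 : (fun ν : Measure (EuclideanSpace ℝ (Fin 3)) => (∫ y, lennardJones ‖y‖ ∂ν) / 2) =ᵐ[P']
        rootEnergy' := hcore'.mono fun ν hν => (rootEnergy'_eq_of_hc hδ' hν).symm
    have hae2 : (fun μ : Measure (EuclideanSpace ℝ (Fin 3)) => (∫ y, lennardJones ‖y‖ ∂μ) / 2) =ᵐ[PH]
        rootEnergy' := hcoreH'.mono fun μ hμ => (rootEnergy'_eq_of_hc hδ' hμ).symm
    have e1 : meanRootEnergy P' = ∫ μ, rootEnergy' (T μ) ∂PH := by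
      unfold meanRootEnergy
      rw [integral_congr_ae hae1]
      exact integral_map hTm.aemeasurable measurable_rootEnergy'.aestronglyMeasurable
    have e2 : meanRootEnergy PH = ∫ μ, rootEnergy' μ ∂PH := by
      unfold meanRootEnergy
      rw [integral_congr_ae hae2]
    have e3 : ∫ μ, rootEnergy' (T μ) ∂PH ≤ ∫ μ, (rootEnergy' μ + lennardJones ‖v‖ / 2) ∂PH := by
      refine integral_mono_ae hint1 (hint2.add (integrable_const _)) ?_
      refine hcoreH.mono fun μ hμ => ?_
      obtain ⟨S, h0, hsep, hS⟩ := hμ.1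
      have hnb := (count_restrict_mem_stackEvent_iff S v).1 (hS ▸ hμ.2)
      have h := rootEnergy'_stack_le hδ h0 hsep v hnb
      rw [← hS] at h
      exact h
    have e4 : ∫ μ, (rootEnergy' μ + lennardJones ‖v‖ / 2) ∂PH =
        (∫ μ, rootEnergy' μ ∂PH) + lennardJones ‖v‖ / 2 := by
      rw [integral_add hint2 (integrable_const _), integral_const, probReal_univ, one_smul]
    rw [e1, e2]
    linarith
  have hVt : lennardJones ‖v‖ < 0 :=
    Literature.MathematicalPhysics.StatisticalMechanics.lennardJones_neg hv
  linarith

end NoSlabs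

open Literature.Probability.Process
open Literature.MathematicalPhysics.StatisticalMechanics (lennardJones)
open Summit.AtomisticToContinuum.Crystallization.Theorems.MinimiserShells.Negative.LoadBearing
  (eStar meanRootEnergy)
open NoSlabs

/-- **Stub `stub_noSlabs`** of line `purity_stacking` (crux `IsometryAtoms.MinimisingLawsCohesive`,
stmt-AtomisticToContinuum-15777).  Given the energy floor `e* ≤ E_P[rootEnergy]` on the frame of
point-stationary a.s. rooted hard-core probability laws, a MINIMISING law (`E_P[rootEnergy] ≤ e*`)
almost surely charges no SLAB configuration (one whose points have bounded height `|A y 0| ≤ D`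
for some linear isometry `A`).  Proof (stacking): a slab configuration `count|S` has no bad pair
for some period `v = t e_j`, `t ∈ ℕ`, `t ≥ 2` (`noSlabs_exists_noBadPair_of_slab`), i.e. lies in one of
countably many measurable, re-rooting-invariant STACKING EVENTS (`count_restrict_mem_stackEvent_iff`);
each such event is null (`measure_stackEvent_eq_zero`): conditioning on it keeps the law minimising
(`meanRootEnergy_cond_le_of_minimising_ae`), stacking `μ ↦ Σₖ θ_{k v} μ` keeps it in the frame
(`noSlabs_isRootedHardCore_stack`, `isPointStationaryLaw_map_stack`) and lowers the mean root energy by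
`-V_LJ(t)/2 > 0` (`rootEnergy'_stack_le`), contradicting the floor. -/
theorem stub_noSlabs :
    (∀ δ : ℝ, 0 < δ →
      ∀ P : MeasureTheory.Measure (MeasureTheory.Measure (EuclideanSpace ℝ (Fin 3))),
        MeasureTheory.IsProbabilityMeasure P →
        (∀ᵐ μ ∂P, Literature.Probability.Process.IsRootedHardCore δ μ) →
        Literature.Probability.Process.IsPointStationaryLaw P →
        (⨅ Q : Literature.MathematicalPhysics.StatisticalMechanics.PeriodicConfiguration 3,
            Q.energyPerParticle Literature.MathematicalPhysics.StatisticalMechanics.lennardJones) ≤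
          ∫ μ, Literature.MathematicalPhysics.StatisticalMechanics.rootEnergy
            Literature.MathematicalPhysics.StatisticalMechanics.lennardJones μ ∂P) →
    ∀ δ : ℝ, 0 < δ →
      ∀ P : MeasureTheory.Measure (MeasureTheory.Measure (EuclideanSpace ℝ (Fin 3))),
        MeasureTheory.IsProbabilityMeasure P →
        (∀ᵐ μ ∂P, Literature.Probability.Process.IsRootedHardCore δ μ) →
        Literature.Probability.Process.IsPointStationaryLaw P →
        (∫ μ, Literature.MathematicalPhysics.StatisticalMechanics.rootEnergy
            Literature.MathematicalPhysics.StatisticalMechanics.lennardJones μ ∂P) ≤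
          (⨅ Q : Literature.MathematicalPhysics.StatisticalMechanics.PeriodicConfiguration 3,
            Q.energyPerParticle Literature.MathematicalPhysics.StatisticalMechanics.lennardJones) →
        ∀ᵐ μ ∂P, ¬ ∃ A : EuclideanSpace ℝ (Fin 3) →ₗᵢ[ℝ] EuclideanSpace ℝ (Fin 3), ∃ D : ℝ,
            ∀ y : EuclideanSpace ℝ (Fin 3), μ {y} ≠ 0 → |A y 0| ≤ D := by
  intro hU δ hδ P hP hcore hstat hE
  have heneg : eStar < 0 :=
    lt_of_le_of_lt PricedLinkCensusLocalToGlobalPhaseGap.eStar_le_neg (by norm_num)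
  have hU' : ∀ δ : ℝ, 0 < δ → ∀ P : Measure (Measure (EuclideanSpace ℝ (Fin 3))), IsProbabilityMeasure P →
      (∀ᵐ μ ∂P, IsRootedHardCore δ μ) → IsPointStationaryLaw P → eStar ≤ meanRootEnergy P :=
    fun δ hδ P hP hc hs => hU δ hδ P hP hc hs
  have hE' : meanRootEnergy P ≤ eStar := hE
  have hnull : ∀ j : Fin 3, ∀ t : ℕ, 2 ≤ t →
      P {μ : Measure (EuclideanSpace ℝ (Fin 3)) | ∀ k : ℤ, k ≠ 0 → ∀ n a : ℕ,
        μ (Metric.ball (TopologicalSpace.denseSeq (EuclideanSpace ℝ (Fin 3)) n) (1 / ((a : ℝ) + 1))) = 0 ∨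
        μ (Metric.ball (TopologicalSpace.denseSeq (EuclideanSpace ℝ (Fin 3)) n -
          (k : ℝ) • ((t : ℝ) • EuclideanSpace.single j (1 : ℝ))) (1 - 1 / ((a : ℝ) + 1))) = 0} = 0 := by
    intro j t ht
    refine measure_stackEvent_eq_zero heneg hU' hδ P hcore hstat hE' ?_
    have h1 : ‖(t : ℝ) • EuclideanSpace.single j (1 : ℝ)‖ = t := by
      rw [norm_smul]
      simp
    rw [h1]
    exact_mod_cast ht
  have hae : ∀ᵐ μ ∂P, ∀ j : Fin 3, ∀ t : ℕ, 2 ≤ t →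
      μ ∉ {μ : Measure (EuclideanSpace ℝ (Fin 3)) | ∀ k : ℤ, k ≠ 0 → ∀ n a : ℕ,
        μ (Metric.ball (TopologicalSpace.denseSeq (EuclideanSpace ℝ (Fin 3)) n) (1 / ((a : ℝ) + 1))) = 0 ∨
        μ (Metric.ball (TopologicalSpace.denseSeq (EuclideanSpace ℝ (Fin 3)) n -
          (k : ℝ) • ((t : ℝ) • EuclideanSpace.single j (1 : ℝ))) (1 - 1 / ((a : ℝ) + 1))) = 0} := by
    rw [ae_all_iff]
    intro j
    rw [ae_all_iff]
    intro t
    by_cases ht : 2 ≤ t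
    · filter_upwards [measure_eq_zero_iff_ae_notMem.1 (hnull j t ht)] with μ hμ using fun _ => hμ
    · exact Eventually.of_forall fun μ h => absurd h ht
  filter_upwards [hcore, hae] with μ hc hn
  rintro ⟨A, D, hAD⟩
  obtain ⟨S, h0, hsep, rfl⟩ := hc
  obtain ⟨j, t, ht, hnb⟩ := noSlabs_exists_noBadPair_of_slab S A D
    (fun s hs => hAD s ((count_restrict_singleton_ne_zero_iff S s).2 hs))
  exact hn j t ht ((count_restrict_mem_stackEvent_iff S _).2 hnb)

end Summit.AtomisticToContinuum.Crystallization.Theorems.IsometryAtomsMinimisingLawsCohesive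

end
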